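import Literature.NumberTheory.LFunctions.Zhang2022.Section12CWindows

/-!
# Zhang (2022) §12: (12.14) AS PRINTED follows from (12.13) AS TYPED — `Eq1213 c′ → Eq1214 c′`

Topic `Literature/NumberTheory/LFunctions/Zhang2022` (Landau–Siegel audit tree; verdict-neutral).
Y. Zhang, *Discrete mean estimates and the Landau–Siegel zero*, arXiv:2211.02515v1 (2022)
[Zhang2022LandauSiegel]. **Status of the source: an unrefereed manuscript under adjudication** (ZHANG-L
discharge lane, WP12; GAP row G-d38-1). Everything in this file is PROVED (theorems only, one of them a kernel
certificate by `decide`; no definitions, no new named fact); nothing here is a claim about Theorems 1–2 of the source or about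
Landau–Siegel zeros.

**Result (kernel-checked).** `eq1214_of_eq1213 : ∀ c′, Eq1213 c′ → Eq1214 c′`: the printed (12.14)
(`Typed.Sec12C.Eq1214`, slack `𝔞/(0.504 log P)·ε/4`, `|ε| < 10⁻⁵`) follows from the printed (12.13)
(`Typed.Sec12C.Eq1213`, second form, with its `ε₂ⱼ`-carrier `10⁻⁵·maj1213int`) for every `c′`.

**Why this is not the printed route.** The manuscript passes (12.13) → (12.14) through the two p. 72 window
displays "`∫ … = −0.002 + ε/10`", "`∫ … = −0.004 − πi/250² + ε/10`" (u039/u043); read with tolerance `10⁻⁶`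
each, the triangle inequality only yields `0.557ε` in (12.14), not `ε/4` (TEAM R certificate;
`Sec12D.printed_slack_1214_lt_derived`, `Sec12D.eq1214_with_derived_slack`). Here the (12.14) bracket is bounded
DIRECTLY: `main1213int − main1214 = 𝔞/(0.504 log P)·(Z_D − bracket1214)` where `Z_D = ῑ₃I₆/0.498 + ῑ₄I₇/0.5` is
built on the explicit weight `𝓦⁰_j(P^z)`; (i) `𝓦⁰_j(P^z) = wLin_j(z) + (ρz + σ)` with `|ρz + σ| ≤ K(c′)𝓛⁻⁸` on
`[0.496, 0.5]` (the p. 72 "good approximation", exactly as in `Section12CWindows`), so `‖Z_D − Z_lin‖ ≤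
K(c′)𝓛⁻⁸·(‖ι₃‖M₆/0.498 + ‖ι₄‖M₇/0.5)` (`M₆ = ∫|𝔣𝔣_{j6}|`, `M₇ = ∫|𝔣𝔣_{j7}|`); (ii) a NEW kernel certificate
`cert1214sharp` on the num lane's boxes `Numerics.ZDB` gives `‖Z_lin − bracket1214‖ < 2.3·10⁻⁶` for `j = 1,2,3`
(values `2.11, 2.11, 1.37 ·10⁻⁶`; the tree's `Numerics.eq1214_lin_*` certify only `< 2.5·10⁻⁶`); (iii)
`|𝔣𝔣_{a,k}(u)| = √(1 + a²π²u²) ≤ 1.0002` on the windows, so `M₆ ≤ 0.0020004`, `M₇ ≤ 0.0040008`, `‖ι₃‖ ≤ 1.0319`,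
`‖ι₄‖ ≤ 1.7478`, and the `ε₂ⱼ`-carrier of (12.13) is `≤ 𝔞/(0.504 log P)·1.82·10⁻⁷`; (iv) `2.3 + 0.183 < 2.5`
(`·10⁻⁶`), the `𝓛⁻⁸`-term being absorbed for `D ≥ D₀(c′)`. So the DED edge (12.13) → (12.14) of GAP row G-d38-1
holds with the printed constant, by a sharper evaluation of the author's own linearised reading than the
printed intermediate roundings record; the v19 leaf `h1214 : Eq1214 c′` is thereby reduced to the typed display
(12.13) `Eq1213 c′` (no new node).

What this is NOT: a proof of (12.13) (`Eq1213` stays a CLAIM node: Lemmas 8.2, 8.3, 12.3 and the window-sum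
evaluation below it), nor any statement about the `ε_{2j}` of Lemma 12.3 (whose printed pointwise bound is
refuted in the main-value reading, `Numerics.not_lemma123Pointwise_num_*`).

## References

* Y. Zhang, arXiv:2211.02515v1 (2022), §12 p. 72, (12.13)–(12.14), tex L3614–L3656; (2.13), (2.26).
  [cite: Zhang2022LandauSiegel, §12 (12.13)–(12.14) p.72]
-/

noncomputable section

open Complex Real ComplexConjugate
open Literature.Analysis.ValidatedNumerics.Numerics

namespace Literature.NumberTheory.LFunctions.Zhang2022.Typed.Sec12C

open Literature.NumberTheory.LFunctions.Zhang2022.Skeleton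
open Literature.NumberTheory.LFunctions.Zhang2022.Numerics (wLin I6 I7 ffj6 ffj7 Z1214 bracket1214 ZDB
  mem_ZDB mem_windows_lin)

/-! ## (ii) The sharper kernel certificate of the (12.14) bracket in the linearised reading -/

section Certificate

/- Keep the interval primitives opaque to the elaborator's unifier (as in `NumericsSection12Windows`). -/
attribute [local irreducible] CB.add CB.sub CB.mul CB.neg CB.conj CB.mulFI CB.mulI CB.mulInt
  CB.ofFI CB.ofInt CB.normSqFI CB.expI FI.add FI.sub FI.mul FI.neg FI.mulInt FI.divNat FI.divPos
  FI.ofRat FI.ofInt FI.pi qCB piMul expIpi overPiFI piISq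

/-- **The kernel check**: the certificate comparisons for (12.14)ⱼ in the linearised reading at the SHARPER
threshold `normSq < 5.29·10⁻¹²`, i.e. `|Z_j − bracket| < 2.3·10⁻⁶` (boxes `Numerics.ZDB` of the num lane, N-07;
thresholds `q·2⁴⁸` against the integer endpoints). [cite: Zhang2022LandauSiegel, §12 (12.14) p.72] -/
theorem cert1214sharp :
    (((ZDB (1/2) (3/2) 2).normSqFI.hi : ℚ) < (529/100000000000000 : ℚ) * (SC : ℚ))
    ∧ (((ZDB (-1/2) (1/2) 1).normSqFI.hi : ℚ) < (529/100000000000000 : ℚ) * (SC : ℚ))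
    ∧ (((ZDB (-3/2) (-1/2) 0).normSqFI.hi : ℚ) < (529/100000000000000 : ℚ) * (SC : ℚ)) := by
  decide +kernel

/-- From `normSq z < 5.29·10⁻¹²`: `‖z‖ < 2.3·10⁻⁶`. [folklore] -/
private theorem norm_lt_23 {z : ℂ} (h : Complex.normSq z < ((529/100000000000000 : ℚ) : ℝ)) :
    ‖z‖ < 23 / 10 ^ 7 := by
  have h0 : 0 ≤ ‖z‖ := norm_nonneg z
  rw [Complex.normSq_eq_norm_sq] at h
  have h2 : ((529/100000000000000 : ℚ) : ℝ) = (23 / 10 ^ 7) ^ 2 := by norm_num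
  rw [h2] at h
  exact lt_of_pow_lt_pow_left₀ 2 (by norm_num) h

/-- **(12.14), linearised reading, sharpened**: `‖Z_j(wLin) − bracket1214‖ < 2.3·10⁻⁶` for `j = 1, 2, 3`
(values `2.11·10⁻⁶, 2.11·10⁻⁶, 1.37·10⁻⁶`). [cite: Zhang2022LandauSiegel, §12 (12.14) p.72] -/
theorem norm_Z1214_lin_sub_bracket_lt {j : ℕ} (hj : j ∈ ({1, 2, 3} : Finset ℕ)) :
    ‖Z1214 wLin j - bracket1214‖ < 23 / 10 ^ 7 := by
  simp only [Finset.mem_insert, Finset.mem_singleton] at hj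
  rcases hj with rfl | rfl | rfl
  · exact norm_lt_23 (hi_bound (CB.mem_normSqFI (mem_ZDB mem_windows_lin.1.1 mem_windows_lin.1.2))
      cert1214sharp.1)
  · exact norm_lt_23 (hi_bound (CB.mem_normSqFI (mem_ZDB mem_windows_lin.2.1.1 mem_windows_lin.2.1.2))
      cert1214sharp.2.1)
  · exact norm_lt_23 (hi_bound (CB.mem_normSqFI (mem_ZDB mem_windows_lin.2.2.1 mem_windows_lin.2.2.2))
      cert1214sharp.2.2)

end Certificate

/-! ## (i) The explicit weight `𝓦⁰_j(P^z)` is the linearised weight plus an affine term of size `K(c′)𝓛⁻⁸` -/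

section Perturbation

variable {c' : ℝ} {D : ℕ}

/-- `log(P^z/P″₁) = (z − 0.496)log P − (𝓛 + log t₀)` (`P″₁ = P^{0.496}Dt₀`, `𝓛 = log D`), for `𝓛 ≥ 1`
(as in `Section12CWindows`). [cite: Zhang2022LandauSiegel, §12 p.71 (definition of `P″₁`)] -/
private theorem log_rpow_div_P1pp_eq (hL1 : 1 ≤ ell D) (z : ℝ) :
    Real.log (bigP D ^ z / P1pp D) = (z - 0.496) * Real.log (bigP D) - (ell D + Real.log (t0 D)) := by
  have hP : 0 < bigP D := Real.exp_pos _
  have hD : (1 : ℝ) < D := by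
    rw [ell] at hL1
    by_contra h
    have := Real.log_nonpos (Nat.cast_nonneg D) (not_lt.mp h)
    linarith
  have hD0 : (0 : ℝ) < D := by linarith
  have ht0 : 0 < t0 D := by rw [t0]; exact pow_pos (by linarith) _
  have hPz : 0 < bigP D ^ z := Real.rpow_pos_of_pos hP z
  have hP496 : 0 < bigP D ^ (0.496 : ℝ) := Real.rpow_pos_of_pos hP _
  have hP1pp : P1pp D = bigP D ^ (0.496 : ℝ) * D * t0 D := rfl
  rw [Real.log_div hPz.ne' (by rw [hP1pp]; exact mul_ne_zero (mul_ne_zero hP496.ne' hD0.ne') ht0.ne'),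
    hP1pp, Real.log_mul (mul_ne_zero hP496.ne' hD0.ne') ht0.ne', Real.log_mul hP496.ne' hD0.ne',
    Real.log_rpow hP, Real.log_rpow hP, ell]
  ring

/-- The `D`-dependent part of `𝓦⁰_j(P^z)`, quantitatively (the argument of `Section12CWindows`, with the
bound kept as `K(c′)𝓛⁻⁸` instead of `10⁻⁵`): from `B·log P − k = m c′(α𝓛)πi` (`|m| ≤ 8`, `|k| ≤ 2π`),
`−1 + B·log(P^z/P″₁) = (−1 + k(z − 0.496)) + (ρz + σ)` with `|ρz + σ| ≤ K(c′)𝓛⁻⁸` on `[0.496, 0.5]`,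
`K(c′) = 0.004·8|c′|π² + 520(2π + 8|c′|π²)`. [cite: Zhang2022LandauSiegel, §12 (12.14) p.72] -/
private theorem decomp_of_key_quant (hL1 : 1 ≤ ell D) {B kk : ℂ} {m : ℝ}
    (key : B * (Real.log (bigP D) : ℂ) - kk = ((m * c' * (alpha D * ell D) * π : ℝ) : ℂ) * I)
    (hm : |m| ≤ 8) (hkk : ‖kk‖ ≤ 2 * π) :
    ∃ ρ σ : ℂ, (∀ z : ℝ, -1 + B * (Real.log (bigP D ^ z / P1pp D) : ℂ) =
        (-1 + kk * ((z : ℂ) - 0.496)) + (ρ * z + σ)) ∧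
      ∀ z ∈ Set.Icc (0.496 : ℝ) 0.5, ‖ρ * z + σ‖ ≤
        (0.004 * (8 * |c'| * π ^ 2) + 520 * (2 * π + 8 * |c'| * π ^ 2)) / ell D ^ 8 := by
  -- adapted from `Section12CWindows.decomp_of_key` (private there), last step removed
  have hLval : Real.log (bigP D) = ell D ^ 9 := by rw [bigP, Real.log_exp]
  have hℓ : 0 < ell D := by linarith
  have h8 : 0 < ell D ^ 8 := pow_pos hℓ 8
  have h9 : 0 < ell D ^ 9 := pow_pos hℓ 9
  have hαℓ : alpha D * ell D = π / ell D ^ 8 := alpha_mul_ell D hL1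
  refine ⟨B * (Real.log (bigP D) : ℂ) - kk,
    -(0.496 : ℂ) * (B * (Real.log (bigP D) : ℂ) - kk) - B * ((ell D + Real.log (t0 D) : ℝ) : ℂ),
    fun z => ?_, fun z hz => ?_⟩
  · rw [log_rpow_div_P1pp_eq hL1 z]
    push_cast
    ring
  · have hρ : ‖B * (Real.log (bigP D) : ℂ) - kk‖ ≤ 8 * |c'| * π ^ 2 / ell D ^ 8 := by
      rw [key, norm_mul, Complex.norm_I, mul_one, Complex.norm_real, Real.norm_eq_abs, hαℓ,
        abs_mul, abs_mul, abs_mul, abs_div, abs_of_pos Real.pi_pos, abs_of_pos h8]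
      have hx : 0 ≤ |c'| * (π / ell D ^ 8) * π := by positivity
      calc |m| * |c'| * (π / ell D ^ 8) * π = |m| * (|c'| * (π / ell D ^ 8) * π) := by ring
        _ ≤ 8 * (|c'| * (π / ell D ^ 8) * π) := mul_le_mul_of_nonneg_right hm hx
        _ = 8 * |c'| * π ^ 2 / ell D ^ 8 := by ring
    have hBL : ‖B‖ * ell D ^ 9 ≤ 2 * π + 8 * |c'| * π ^ 2 := by
      have e : B * (Real.log (bigP D) : ℂ) = kk + (B * (Real.log (bigP D) : ℂ) - kk) := by ring
      have h1 : ‖B‖ * ell D ^ 9 = ‖B * (Real.log (bigP D) : ℂ)‖ := by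
        rw [norm_mul, Complex.norm_real, Real.norm_eq_abs, hLval, abs_of_pos h9]
      rw [h1, e]
      calc ‖kk + (B * (Real.log (bigP D) : ℂ) - kk)‖
          ≤ ‖kk‖ + ‖B * (Real.log (bigP D) : ℂ) - kk‖ := norm_add_le _ _
        _ ≤ 2 * π + 8 * |c'| * π ^ 2 / ell D ^ 8 := add_le_add hkk hρ
        _ ≤ 2 * π + 8 * |c'| * π ^ 2 := by
            have : 8 * |c'| * π ^ 2 / ell D ^ 8 ≤ 8 * |c'| * π ^ 2 :=
              div_le_self (by positivity) (one_le_pow₀ hL1)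
            linarith
    have hlog : Real.log (t0 D) = 519 * Real.log (ell D) := by
      rw [t0, Real.log_pow]; push_cast; ring
    have hM0 : 0 ≤ ell D + Real.log (t0 D) := by
      have : 0 ≤ Real.log (ell D) := Real.log_nonneg hL1
      rw [hlog]; nlinarith
    have hM : ell D + Real.log (t0 D) ≤ 520 * ell D := by
      have : Real.log (ell D) ≤ ell D := (Real.log_le_sub_one_of_pos hℓ).trans (by linarith)
      rw [hlog]; nlinarith
    have hB : ‖B‖ ≤ (2 * π + 8 * |c'| * π ^ 2) / ell D ^ 9 := by
      rw [le_div_iff₀ h9]; exact hBL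
    have hBM : ‖B * ((ell D + Real.log (t0 D) : ℝ) : ℂ)‖ ≤
        520 * (2 * π + 8 * |c'| * π ^ 2) / ell D ^ 8 := by
      rw [norm_mul, Complex.norm_real, Real.norm_eq_abs, abs_of_nonneg hM0]
      calc ‖B‖ * (ell D + Real.log (t0 D))
          ≤ (2 * π + 8 * |c'| * π ^ 2) / ell D ^ 9 * (520 * ell D) :=
            mul_le_mul hB hM hM0 (by positivity)
        _ = 520 * (2 * π + 8 * |c'| * π ^ 2) / ell D ^ 8 := by
            field_simp
    obtain ⟨hz1, hz2⟩ := hz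
    have hzabs : ‖((z : ℂ) - 0.496)‖ ≤ 0.004 := by
      have e : ((z : ℂ) - 0.496) = ((z - 0.496 : ℝ) : ℂ) := by push_cast; ring
      rw [e, Complex.norm_real, Real.norm_eq_abs, abs_le]
      constructor <;> linarith
    have e : (B * (Real.log (bigP D) : ℂ) - kk) * (z : ℂ) +
        (-(0.496 : ℂ) * (B * (Real.log (bigP D) : ℂ) - kk) - B * ((ell D + Real.log (t0 D) : ℝ) : ℂ))
        = (B * (Real.log (bigP D) : ℂ) - kk) * ((z : ℂ) - 0.496)
          - B * ((ell D + Real.log (t0 D) : ℝ) : ℂ) := by ring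
    rw [e]
    calc ‖(B * (Real.log (bigP D) : ℂ) - kk) * ((z : ℂ) - 0.496) - B * ((ell D + Real.log (t0 D) : ℝ) : ℂ)‖
        ≤ ‖(B * (Real.log (bigP D) : ℂ) - kk) * ((z : ℂ) - 0.496)‖
            + ‖B * ((ell D + Real.log (t0 D) : ℝ) : ℂ)‖ := norm_sub_le _ _
      _ ≤ (8 * |c'| * π ^ 2 / ell D ^ 8) * 0.004 + 520 * (2 * π + 8 * |c'| * π ^ 2) / ell D ^ 8 := by
          rw [norm_mul]
          exact add_le_add (mul_le_mul hρ hzabs (norm_nonneg _) (by positivity)) hBM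
      _ = (0.004 * (8 * |c'| * π ^ 2) + 520 * (2 * π + 8 * |c'| * π ^ 2)) / ell D ^ 8 := by ring

/-- **`𝓦⁰_j(P^z) = wLin_j(z) + (ρz + σ)`, `|ρz + σ| ≤ K(c′)𝓛⁻⁸` on `[0.496, 0.5]`** (`j = 1,2,3`, `𝓛 ≥ 1`): the
p. 72 "good approximation `𝓦_j(P^z) ≃ −1 + (3−j)πi(z − 0.496)`" made quantitative on the explicit part
`𝓦⁰_j` (by (2.13) with `α log P = π`: `(−2β₆ + β_{j+1} + β_{j+2})log P = (3 − j)πi + m_jc′(α𝓛)πi`,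
`m_j = −1, −8, −3`). [cite: Zhang2022LandauSiegel, §12 (12.14) p.72, tex L3632–L3648] -/
theorem frakw0_rpow_eq_wLin_add (c' : ℝ) (hL1 : 1 ≤ ell D) {j : ℕ} (hj : j ∈ ({1, 2, 3} : Finset ℕ)) :
    ∃ ρ σ : ℂ, (∀ z : ℝ, frakw0 c' D j (bigP D ^ z) = wLin j z + (ρ * z + σ)) ∧
      ∀ z ∈ Set.Icc (0.496 : ℝ) 0.5, ‖ρ * z + σ‖ ≤
        (0.004 * (8 * |c'| * π ^ 2) + 520 * (2 * π + 8 * |c'| * π ^ 2)) / ell D ^ 8 := by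
  have hA : ((alpha D : ℝ) : ℂ) * (Real.log (bigP D) : ℝ) = (π : ℂ) := by
    rw [← Complex.ofReal_mul, alpha_mul_log_bigP D hL1]
  have hπ : ‖(π : ℂ)‖ = π := by rw [Complex.norm_real, Real.norm_eq_abs, abs_of_pos Real.pi_pos]
  simp only [Finset.mem_insert, Finset.mem_singleton] at hj
  rcases hj with rfl | rfl | rfl
  · have key : (-2 * beta6 D + betaJ c' D (1 + 1) + betaJ c' D (1 + 2)) * (Real.log (bigP D) : ℂ)
        - 2 * π * I = (((-1) * c' * (alpha D * ell D) * π : ℝ) : ℂ) * I := by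
      norm_num only [betaJ, beta6, beta1, beta2, beta3]
      push_cast
      linear_combination (I * (2 - (c' : ℂ) * (alpha D : ℂ) * (ell D : ℂ))) * hA
    obtain ⟨ρ, σ, h1, h2⟩ := decomp_of_key_quant hL1 key (by norm_num)
      (by rw [norm_mul, norm_mul, Complex.norm_I, hπ]; norm_num)
    refine ⟨ρ, σ, fun z => ?_, h2⟩
    change -1 + (-2 * beta6 D + betaJ c' D (1 + 1) + betaJ c' D (1 + 2)) *
        (Real.log (bigP D ^ z / P1pp D) : ℂ) = _
    rw [h1 z]
    unfold Numerics.wLin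
    push_cast
    ring
  · have key : (-2 * beta6 D + betaJ c' D (2 + 1) + betaJ c' D (2 + 2)) * (Real.log (bigP D) : ℂ)
        - π * I = (((-8) * c' * (alpha D * ell D) * π : ℝ) : ℂ) * I := by
      norm_num only [betaJ, beta6, beta1, beta2, beta3]
      push_cast
      linear_combination (I * (1 - 8 * (c' : ℂ) * (alpha D : ℂ) * (ell D : ℂ))) * hA
    obtain ⟨ρ, σ, h1, h2⟩ := decomp_of_key_quant hL1 key (by norm_num)
      (by rw [norm_mul, Complex.norm_I, hπ]; linarith [Real.pi_pos])
    refine ⟨ρ, σ, fun z => ?_, h2⟩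
    change -1 + (-2 * beta6 D + betaJ c' D (2 + 1) + betaJ c' D (2 + 2)) *
        (Real.log (bigP D ^ z / P1pp D) : ℂ) = _
    rw [h1 z]
    unfold Numerics.wLin
    push_cast
    ring
  · have key : (-2 * beta6 D + betaJ c' D (3 + 1) + betaJ c' D (3 + 2)) * (Real.log (bigP D) : ℂ)
        - 0 = (((-3) * c' * (alpha D * ell D) * π : ℝ) : ℂ) * I := by
      norm_num only [betaJ, beta6, beta1, beta2, beta3]
      push_cast
      linear_combination (I * (-3 * (c' : ℂ) * (alpha D : ℂ) * (ell D : ℂ))) * hA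
    obtain ⟨ρ, σ, h1, h2⟩ := decomp_of_key_quant hL1 key (by norm_num)
      (by rw [norm_zero]; positivity)
    refine ⟨ρ, σ, fun z => ?_, h2⟩
    change -1 + (-2 * beta6 D + betaJ c' D (3 + 1) + betaJ c' D (3 + 2)) *
        (Real.log (bigP D ^ z / P1pp D) : ℂ) = _
    rw [h1 z]
    unfold Numerics.wLin
    push_cast
    ring

/-- Window perturbation: `‖∫_a^b f(z)(ρz + σ)dz‖ ≤ δ∫_a^b|f|` when `|ρz + σ| ≤ δ` on `[a, b]`. [folklore] -/
private theorem norm_integral_mul_affine_le {a b δ : ℝ} (hab : a ≤ b) {f : ℝ → ℂ} (hf : Continuous f)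
    (ρ σ : ℂ) (hδ : ∀ z ∈ Set.Icc a b, ‖ρ * z + σ‖ ≤ δ) :
    ‖∫ z in a..b, f z * (ρ * z + σ)‖ ≤ δ * ∫ z in a..b, ‖f z‖ := by
  rw [← intervalIntegral.integral_const_mul]
  refine intervalIntegral.norm_integral_le_of_norm_le hab ?_ ?_
  · refine Filter.Eventually.of_forall fun z hz => ?_
    rw [norm_mul, mul_comm]
    exact mul_le_mul_of_nonneg_right (hδ z (Set.Ioc_subset_Icc_self hz)) (norm_nonneg _)
  · exact Continuous.intervalIntegrable (by fun_prop) _ _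

end Perturbation

/-! ## (iii) Sizes: `|𝔣𝔣_{a,k}| ≤ 1.0002` on the windows, `‖ι₃‖ ≤ 1.0319`, `‖ι₄‖ ≤ 1.7478` -/

section Sizes

/-- `|𝔣𝔣_{a,k}(u)| = √(1 + a²π²u²) ≤ 1.0002` for `|a| ≤ 3/2`, `0 ≤ u ≤ 0.004` ((8.13)–(8.18): `|e^{kπiu}| = 1`).
[cite: Zhang2022LandauSiegel, §8 (8.13)–(8.18) p.48] -/
private theorem norm_ffF_le {a k : ℚ} (ha : |(a : ℝ)| ≤ 3 / 2) {u : ℝ} (hu0 : 0 ≤ u) (hu : u ≤ 0.004) :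
    ‖ffF a k u‖ ≤ 1.0002 := by
  rw [ffF, norm_mul]
  have h2 : ‖cexp ((k : ℂ) * π * I * u)‖ = 1 := by
    have e : (k : ℂ) * π * I * u = (((k : ℝ) * π * u : ℝ) : ℂ) * I := by push_cast; ring
    rw [e, Complex.norm_exp_ofReal_mul_I]
  rw [h2, mul_one]
  have e1 : (1 : ℂ) + a * π * I * u = ((1 : ℝ) : ℂ) + (((a : ℝ) * π * u : ℝ) : ℂ) * I := by
    push_cast; ring
  have hsq : ‖(1 : ℂ) + a * π * I * u‖ ^ 2 = 1 + ((a : ℝ) * π * u) ^ 2 := by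
    rw [e1, Complex.sq_norm, Complex.normSq_add_mul_I]; ring
  have hx : |(a : ℝ) * π * u| ≤ 3 / 2 * 3.15 * 0.004 := by
    rw [abs_mul, abs_mul, abs_of_pos Real.pi_pos, abs_of_nonneg hu0]
    have hπ := Real.pi_lt_d2
    gcongr
  have hx2 : ((a : ℝ) * π * u) ^ 2 ≤ (3 / 2 * 3.15 * 0.004) ^ 2 := by
    rw [← sq_abs]; exact pow_le_pow_left₀ (abs_nonneg _) hx 2
  refine (pow_le_pow_iff_left₀ (norm_nonneg _) (by norm_num) two_ne_zero).mp ?_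
  rw [hsq]
  nlinarith

/-- `∫_{0.496}^{b} |𝔣𝔣_{a,k}(b − z)|dz ≤ 1.0002(b − 0.496)` for `0.496 ≤ b ≤ 0.5`, `|a| ≤ 3/2`.
[cite: Zhang2022LandauSiegel, §12 (12.13) p.71] -/
private theorem integral_norm_ffF_le {a k : ℚ} (ha : |(a : ℝ)| ≤ 3 / 2) {b : ℝ} (hb : 0.496 ≤ b)
    (hb' : b ≤ 0.5) : ∫ z in (0.496:ℝ)..b, ‖ffF a k (b - z)‖ ≤ 1.0002 * (b - 0.496) := by
  have h := intervalIntegral.norm_integral_le_of_norm_le_const (a := (0.496 : ℝ)) (b := b)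
    (f := fun z => ‖ffF a k (b - z)‖) (C := 1.0002) (fun z hz => by
      rw [Set.uIoc_of_le hb] at hz
      rw [norm_norm]
      exact norm_ffF_le ha (by linarith [hz.2]) (by linarith [hz.1]))
  rw [Real.norm_eq_abs, abs_of_nonneg (by linarith : (0 : ℝ) ≤ b - 0.496)] at h
  exact (le_abs_self _).trans h

/-- `‖ι₃‖ ≤ 1.0319`, `‖ι₄‖ ≤ 1.7478` ((2.26): `ι₃ = −1.00635 − 0.22789i`, `ι₄ = −0.68738 + 1.60688i`).
[cite: Zhang2022LandauSiegel, §2 (2.26) p.9] -/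
private theorem norm_iota34_le : ‖iota3‖ ≤ 1.0319 ∧ ‖iota4‖ ≤ 1.7478 := by
  have hre3 : iota3.re = -1.00635 := by simp [iota3]
  have him3 : iota3.im = -0.22789 := by simp [iota3]
  have hre4 : iota4.re = -0.68738 := by simp [iota4]
  have him4 : iota4.im = 1.60688 := by simp [iota4]
  have hsq3 : ‖iota3‖ ^ 2 = 1.00635 ^ 2 + 0.22789 ^ 2 := by
    rw [Complex.sq_norm, Complex.normSq_apply, hre3, him3]; ring
  have hsq4 : ‖iota4‖ ^ 2 = 0.68738 ^ 2 + 1.60688 ^ 2 := by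
    rw [Complex.sq_norm, Complex.normSq_apply, hre4, him4]; ring
  constructor
  · refine (pow_le_pow_iff_left₀ (norm_nonneg _) (by norm_num) two_ne_zero).mp ?_
    rw [hsq3]; norm_num
  · refine (pow_le_pow_iff_left₀ (norm_nonneg _) (by norm_num) two_ne_zero).mp ?_
    rw [hsq4]; norm_num

/-- Norms of the numerical literals `0.498, 0.5 : ℂ`. [folklore] -/
private theorem norm_lits_498_5 : ‖(0.498 : ℂ)‖ = 0.498 ∧ ‖(0.5 : ℂ)‖ = 0.5 := by
  refine ⟨?_, ?_⟩
  · rw [show (0.498 : ℂ) = ((0.498 : ℝ) : ℂ) by norm_num, Complex.norm_real]; norm_num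
  · rw [show (0.5 : ℂ) = ((0.5 : ℝ) : ℂ) by norm_num, Complex.norm_real]; norm_num

/-- The per-`j` profile data: `𝔣𝔣_{j6} = 𝔣𝔣_{a₆,3/2}`, `𝔣𝔣_{j7} = 𝔣𝔣_{a₇,5/2}` with `|a₆|, |a₇| ≤ 3/2`, and the num
lane's `Z1214 wLin j` written on these profiles ((8.13)–(8.18)). [cite: Zhang2022LandauSiegel, §8 (8.13)–(8.18) p.48] -/
private theorem profiles_of_mem {j : ℕ} (hj : j ∈ ({1, 2, 3} : Finset ℕ)) :
    ∃ a6 k6 a7 k7 : ℚ, |(a6 : ℝ)| ≤ 3 / 2 ∧ |(a7 : ℝ)| ≤ 3 / 2 ∧ ffj j 6 = ffF a6 k6 ∧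
      ffj j 7 = ffF a7 k7 ∧
      Z1214 wLin j = conj iota3 * (∫ z in (0.496:ℝ)..0.498, ffF a6 k6 (0.498 - z) * wLin j z) / 0.498 +
        conj iota4 * (∫ z in (0.496:ℝ)..0.5, ffF a7 k7 (0.5 - z) * wLin j z) / 0.5 := by
  simp only [Finset.mem_insert, Finset.mem_singleton] at hj
  rcases hj with rfl | rfl | rfl
  · exact ⟨1/2, 3/2, 3/2, 5/2, by norm_num, by norm_num, rfl, rfl, rfl⟩
  · exact ⟨-1/2, 3/2, 1/2, 5/2, by norm_num, by norm_num, rfl, rfl, rfl⟩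
  · exact ⟨-3/2, 3/2, -1/2, 5/2, by norm_num, by norm_num, rfl, rfl, rfl⟩

end Sizes

/-! ## (iv) The edge (12.13) → (12.14) -/

section Edge

/-- **(12.14) AS PRINTED follows from (12.13) AS TYPED**, for every `c′`: `Eq1213 c′ → Eq1214 c′` — the DED edge
`Z22:(12.13) → Z22:(12.14)` of GAP row G-d38-1 with the printed constant `ε/4`, obtained by bounding the (12.14)
bracket directly (`cert1214sharp`: `2.3·10⁻⁶`; the `ε_{2j}`-carrier of (12.13): `≤ 1.82·10⁻⁷`; the
`𝓛⁻⁸`-perturbation of `𝓦⁰_j`: absorbed for `D ≥ D₀(c′)`) instead of through the two printed "`+ ε/10`" roundings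
(which give only `0.557ε`, `Sec12D.eq1214_with_derived_slack`). No claim about (12.13) itself.
[cite: Zhang2022LandauSiegel, §12 (12.13)–(12.14) p.72, tex L3614–L3656] -/
theorem eq1214_of_eq1213 (c' : ℝ) (h1213 : Eq1213 c') : Eq1214 c' := by
  intro ε hε
  obtain ⟨D₁, hD₁⟩ := ell_large (0.004 * (8 * |c'| * π ^ 2) + 520 * (2 * π + 8 * |c'| * π ^ 2)) 1e-7
    (by positivity) (by norm_num)
  obtain ⟨D₀, h0⟩ := h1213 ε hε
  refine ⟨max D₀ D₁, fun D _ χ hD hq hp hA a25 ha25 j hj => ?_⟩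
  obtain ⟨hL1, hK⟩ := hD₁ D (le_trans (le_max_right _ _) hD)
  have hT := ((h0 D χ (le_trans (le_max_left _ _) hD) hq hp) hA a25 ha25 j hj).2
  obtain ⟨a6, k6, a7, k7, ha6, ha7, hf6, hf7, hZlin⟩ := profiles_of_mem hj
  obtain ⟨ρ, σ, hW, hρσ⟩ := frakw0_rpow_eq_wLin_add c' hL1 hj
  have hq := norm_Z1214_lin_sub_bracket_lt hj
  obtain ⟨n3, n4⟩ := norm_iota34_le
  obtain ⟨l498, l5⟩ := norm_lits_498_5
  have hδ : ∀ z ∈ Set.Icc (0.496 : ℝ) 0.5, ‖ρ * z + σ‖ ≤ 1e-7 := fun z hz => (hρσ z hz).trans hK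
  have hδ6 : ∀ z ∈ Set.Icc (0.496 : ℝ) 0.498, ‖ρ * z + σ‖ ≤ 1e-7 :=
    fun z hz => hδ z ⟨hz.1, hz.2.trans (by norm_num)⟩
  -- sizes
  have hAf := frakA_nonneg χ
  have hℓ : 0 < ell D := by linarith
  have hL : 0 < Real.log (bigP D) := by rw [bigP, Real.log_exp]; positivity
  set L := Real.log (bigP D) with hLdef
  have hLc : (L : ℂ) ≠ 0 := by exact_mod_cast hL.ne'
  set A : ℝ := frakA χ / (0.504 * L) with hAdef
  have hA0 : 0 ≤ A := by positivity
  -- the window integrals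
  set I6L := ∫ z in (0.496:ℝ)..0.498, ffF a6 k6 (0.498 - z) * wLin j z with hI6L
  set I7L := ∫ z in (0.496:ℝ)..0.5, ffF a7 k7 (0.5 - z) * wLin j z with hI7L
  set E6 := ∫ z in (0.496:ℝ)..0.498, ffF a6 k6 (0.498 - z) * (ρ * z + σ) with hE6
  set E7 := ∫ z in (0.496:ℝ)..0.5, ffF a7 k7 (0.5 - z) * (ρ * z + σ) with hE7
  set M6 := ∫ z in (0.496:ℝ)..0.498, ‖ffF a6 k6 (0.498 - z)‖ with hM6
  set M7 := ∫ z in (0.496:ℝ)..0.5, ‖ffF a7 k7 (0.5 - z)‖ with hM7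
  have hM60 : 0 ≤ M6 := intervalIntegral.integral_nonneg (by norm_num) fun z _ => norm_nonneg _
  have hM70 : 0 ≤ M7 := intervalIntegral.integral_nonneg (by norm_num) fun z _ => norm_nonneg _
  have hM6le : M6 ≤ 1.0002 * (0.498 - 0.496) := integral_norm_ffF_le ha6 (by norm_num) (by norm_num)
  have hM7le : M7 ≤ 1.0002 * (0.5 - 0.496) := integral_norm_ffF_le ha7 (by norm_num) (by norm_num)
  have hE6le : ‖E6‖ ≤ 1e-7 * M6 :=
    norm_integral_mul_affine_le (by norm_num) ((continuous_ffF a6 k6).comp (by fun_prop)) ρ σ hδ6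
  have hE7le : ‖E7‖ ≤ 1e-7 * M7 :=
    norm_integral_mul_affine_le (by norm_num) ((continuous_ffF a7 k7).comp (by fun_prop)) ρ σ hδ
  -- the `D`-dependent window integrals of `main1213int` split as `lin + E`
  have hwl : Continuous (fun z : ℝ => wLin j z) := by unfold Numerics.wLin; fun_prop
  have hI6D : (∫ z in (0.496:ℝ)..0.498, ffj j 6 (0.498 - z) * frakw0 c' D j (bigP D ^ z)) = I6L + E6 := by
    simp only [hf6, hW]
    rw [hI6L, hE6, ← intervalIntegral.integral_add
      (Continuous.intervalIntegrable (by fun_prop) _ _) (Continuous.intervalIntegrable (by fun_prop) _ _)]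
    refine intervalIntegral.integral_congr fun z _ => ?_
    ring
  have hI7D : (∫ z in (0.496:ℝ)..0.5, ffj j 7 (0.5 - z) * frakw0 c' D j (bigP D ^ z)) = I7L + E7 := by
    simp only [hf7, hW]
    rw [hI7L, hE7, ← intervalIntegral.integral_add
      (Continuous.intervalIntegrable (by fun_prop) _ _) (Continuous.intervalIntegrable (by fun_prop) _ _)]
    refine intervalIntegral.integral_congr fun z _ => ?_
    ring
  -- the exact identity `main1213int − main1214 = A·((Z_lin − bracket) + (ῑ₃E₆/0.498 + ῑ₄E₇/0.5))`
  have hid : main1213int c' χ j - main1214 χ =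
      (A : ℂ) * ((Z1214 wLin j - bracket1214) + (conj iota3 * E6 / 0.498 + conj iota4 * E7 / 0.5)) := by
    rw [main1213int, main1214, hI6D, hI7D, hZlin, ← hLdef, hAdef]
    unfold Numerics.bracket1214
    push_cast
    field_simp
    ring
  have hmaj : maj1213int χ j = A * (‖iota3‖ * M6 / 0.498 + ‖iota4‖ * M7 / 0.5) := by
    rw [maj1213int, hf6, hf7, ← hM6, ← hM7, ← hLdef, hAdef]
    field_simp
  -- norms
  have hnA : ‖(A : ℂ)‖ = A := by rw [Complex.norm_real, Real.norm_of_nonneg hA0]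
  have hpert : ‖conj iota3 * E6 / 0.498 + conj iota4 * E7 / 0.5‖ ≤
      ‖iota3‖ * (1e-7 * M6) / 0.498 + ‖iota4‖ * (1e-7 * M7) / 0.5 := by
    calc ‖conj iota3 * E6 / 0.498 + conj iota4 * E7 / 0.5‖
        ≤ ‖conj iota3 * E6 / 0.498‖ + ‖conj iota4 * E7 / 0.5‖ := norm_add_le _ _
      _ = ‖iota3‖ * ‖E6‖ / 0.498 + ‖iota4‖ * ‖E7‖ / 0.5 := by
          rw [norm_div, norm_div, norm_mul, norm_mul, Complex.norm_conj, Complex.norm_conj, l498, l5]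
      _ ≤ ‖iota3‖ * (1e-7 * M6) / 0.498 + ‖iota4‖ * (1e-7 * M7) / 0.5 := by gcongr
  have hdiff : ‖main1213int c' χ j - main1214 χ‖ ≤
      A * (23 / 10 ^ 7 + (‖iota3‖ * (1e-7 * M6) / 0.498 + ‖iota4‖ * (1e-7 * M7) / 0.5)) := by
    rw [hid, norm_mul, hnA]
    refine mul_le_mul_of_nonneg_left ?_ hA0
    exact (norm_add_le _ _).trans (add_le_add hq.le hpert)
  -- the numerical budget: `2.3·10⁻⁶ + (10⁻⁵ + 10⁻⁷)·S ≤ 2.5·10⁻⁶`, `S ≤ 0.01814`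
  have hS : ‖iota3‖ * M6 / 0.498 + ‖iota4‖ * M7 / 0.5 ≤ 0.01814 := by
    have h1 : ‖iota3‖ * M6 ≤ 1.0319 * (1.0002 * (0.498 - 0.496)) :=
      mul_le_mul n3 hM6le hM60 (by norm_num)
    have h2 : ‖iota4‖ * M7 ≤ 1.7478 * (1.0002 * (0.5 - 0.496)) :=
      mul_le_mul n4 hM7le hM70 (by norm_num)
    have h3 : ‖iota3‖ * M6 / 0.498 + ‖iota4‖ * M7 / 0.5 ≤
        1.0319 * (1.0002 * (0.498 - 0.496)) / 0.498 + 1.7478 * (1.0002 * (0.5 - 0.496)) / 0.5 := by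
      gcongr
    exact h3.trans (by norm_num)
  have hS0 : 0 ≤ ‖iota3‖ * M6 / 0.498 + ‖iota4‖ * M7 / 0.5 := by positivity
  have key : ‖SjOn c' D j (a12 χ) a25 (rngTop D) - main1214 χ‖ ≤
      A * (23 / 10 ^ 7 + (1e-5 + 1e-7) * (‖iota3‖ * M6 / 0.498 + ‖iota4‖ * M7 / 0.5)) + ε * alpha D := by
    have e : A * (23 / 10 ^ 7 + (1e-5 + 1e-7) * (‖iota3‖ * M6 / 0.498 + ‖iota4‖ * M7 / 0.5)) + ε * alpha D
        = (1e-5 * (A * (‖iota3‖ * M6 / 0.498 + ‖iota4‖ * M7 / 0.5)) + ε * alpha D) +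
          A * (23 / 10 ^ 7 + (‖iota3‖ * (1e-7 * M6) / 0.498 + ‖iota4‖ * (1e-7 * M7) / 0.5)) := by ring
    rw [e, ← hmaj]
    exact (norm_sub_le_norm_sub_add_norm_sub _ (main1213int c' χ j) _).trans (add_le_add hT hdiff)
  have hbudget : 23 / 10 ^ 7 + (1e-5 + 1e-7) * (‖iota3‖ * M6 / 0.498 + ‖iota4‖ * M7 / 0.5) ≤
      (1e-5 / 4 : ℝ) := by nlinarith
  calc ‖SjOn c' D j (a12 χ) a25 (rngTop D) - main1214 χ‖
      ≤ A * (23 / 10 ^ 7 + (1e-5 + 1e-7) * (‖iota3‖ * M6 / 0.498 + ‖iota4‖ * M7 / 0.5)) +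
          ε * alpha D := key
    _ ≤ A * (1e-5 / 4) + ε * alpha D := by gcongr
    _ = frakA χ / (0.504 * Real.log (bigP D)) * (1e-5 / 4) + ε * alpha D := by rw [hAdef]

end Edge

end Literature.NumberTheory.LFunctions.Zhang2022.Typed.Sec12C
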